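import Summits.MatrixMultiplication.OmegaCensus.AffineExtensionBoxF1
import Summits.MatrixMultiplication.OmegaCensus.AtomBadCoprime
import Summits.MatrixMultiplication.OmegaCensus.BoxBadAtomsFrobeniusBridge
import Summits.MatrixMultiplication.OmegaCensus.BoxRatioSectionLawReduction

/-!
# ω-census, family (b3): conjecture C9 (b) — the atom hypothesis for EVERY pair of primes, and C9 (b) for all finite solvable groups

HONEST FRAMING (pub-omega census; verbatim): lottery ticket; floor = certified bounds/negative ranges.
Census BOOKKEEPING (conjecture C9 of the cell, STRUCTURE.md §2; pub-omega kernel-l4 gen 18, task K-8).  Nothing here is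
progress on `ω`.

* `MetaCyc.ofAffExt` — `ℤ/N ⋊_u ℤ/q` IS the affine extension `AffExt (ZMod N) q (u·)`; with the one-rotation arc template
  (`AffineExtensionBoxF1.lean`): **`MetaCyc.not_boxUseful_of_prime`** — for every prime `p ≥ 9` with `5⌈p/6⌉ ≤ p` (i.e. every
  prime `p ≥ 11` other than `13, 19`), every `q ≥ 2` and every `u ≠ 1` with `u^q = 1`, the group `ℤ/p ⋊_u ℤ/q` is not
  box-useful.  No arithmetic of `u` modulo `p` enters (compare the phase-arc certificates `BoxBadFrobeniusPhaseCerts1–25`,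
  `FrobeniusUniform` for `q = 3`, and the 19 pattern certificates behind `atomBad_11_5 … atomBad_53_13`, all now subsumed).
* **`atomBad_of_dvd`** — `q ∣ p − 1`, `q ≥ 5` ⇒ `AtomBad p q` (via `atomBad_of_frobenius_models`; such `p` are `≥ 11` and never
  `13` or `19`); with `atomBad_of_not_dvd` (`AtomBadCoprime.lean`): **`atomBad_of_five_le` — `AtomBad p q` for ALL primes
  `p ≠ q`, `q ≥ 5`.**  The atom hypothesis (A) of `BoxRatioSectionLawAtoms.lean` is a theorem.
* **`boxRatioSectionLaw_of_isSolvable_all` — C9 (b) HOLDS FOR EVERY FINITE SOLVABLE GROUP, unconditionally**: a box-useful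
  finite solvable group has centre of index `1`, `4` or `6`, or lies in the class `𝒞₂` (`DihC3Sq.Coord2`).
* `boxRatioSectionLaw_of_simple` — the full law `BoxRatioSectionLaw` follows from the single remaining hypothesis (S): every
  finite non-abelian simple group is box-useless.
-/

namespace Summit.MatrixMultiplication.OmegaCensus

open Finset

universe u

/-! ### `ℤ/N ⋊_u ℤ/q` as an affine extension -/

namespace MetaCyc

variable {N q : ℕ}

/-- Multiplication by `u` as an additive endomorphism of `ZMod N`. [folklore] -/
def mulEnd (u : ZMod N) : AddMonoid.End (ZMod N) := AddMonoidHom.mulLeft u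

/-- `(u·)^k x = u^k x`. [folklore] -/
theorem mulEnd_pow_apply (u : ZMod N) (k : ℕ) (x : ZMod N) : (mulEnd u ^ k) x = u ^ k * x := by
  induction k generalizing x with
  | zero => simp
  | succ k ih => rw [pow_succ, AffExt.end_mul_apply, pow_succ]; change (mulEnd u ^ k) (u * x) = _; rw [ih]; ring

/-- `u^q = 1` gives `(u·)^q = 1`. [folklore] -/
theorem mulEnd_pow_eq_one (u : ZMod N) (hu : u ^ q = 1) : mulEnd u ^ q = 1 := by
  apply AddMonoidHom.ext
  intro x
  change (mulEnd u ^ q) x = x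
  rw [mulEnd_pow_apply, hu, one_mul]

/-- `AffExt.act (u·) t x = MetaCyc.act u t · x`. [folklore] -/
theorem affExt_act_eq (u : ZMod N) (t : ZMod q) (x : ZMod N) : AffExt.act (mulEnd u) t x = act u t * x := by
  rw [AffExt.act, act, mulEnd_pow_apply]

/-- **`ℤ/N ⋊_u ℤ/q` is the affine extension `AffExt (ZMod N) q (u·)`**: the identity on coordinates is a monoid homomorphism
`AffExt (ZMod N) q (u·) →* MetaCyc N q u`. [folklore] -/
def ofAffExt (u : ZMod N) [NeZero q] [Fact (u ^ q = 1)] [Fact (mulEnd u ^ q = 1)] :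
    AffExt (ZMod N) q (mulEnd u) →* MetaCyc N q u where
  toFun x := ⟨x.v, x.t⟩
  map_one' := by rw [AffExt.one_def]; rfl
  map_mul' x y := by
    apply MetaCyc.ext
    · simp only [AffExt.mul_def, MetaCyc.mul_def, affExt_act_eq]
    · simp only [AffExt.mul_def, MetaCyc.mul_def]

/-- `ofAffExt` is injective. [folklore] -/
theorem ofAffExt_injective (u : ZMod N) [NeZero q] [Fact (u ^ q = 1)] [Fact (mulEnd u ^ q = 1)] :
    Function.Injective (ofAffExt (q := q) u) := by
  intro x y h
  have h1 := congrArg MetaCyc.i h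
  have h2 := congrArg MetaCyc.t h
  exact AffExt.ext h1 h2

/-- **The Frobenius groups `ℤ/p ⋊_u ℤ/q`, uniformly.**  For a prime `p ≥ 9` with `5⌈p/6⌉ ≤ p`, any `q ≥ 2` and any `u ≠ 1`
with `u^q = 1`, `MetaCyc p q u` is not box-useful (one-rotation arc template through `AffExt`). [folklore] -/
theorem not_boxUseful_of_prime {p q : ℕ} [Fact p.Prime] [NeZero q] (hq : 1 < q) (hp9 : 9 ≤ p)
    (hL : 5 * ((p + 5) / 6) ≤ p) (u : ZMod p) [hu : Fact (u ^ q = 1)] (hu1 : u ≠ 1) : ¬ BoxUseful (MetaCyc p q u) := by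
  haveI : Fact (mulEnd u ^ q = 1) := ⟨mulEnd_pow_eq_one u hu.out⟩
  haveI : Fact (1 < q) := ⟨hq⟩
  have h1 : (1 : ZMod q) ≠ 0 := by
    intro h0
    have := congrArg ZMod.val h0
    rw [ZMod.val_one, ZMod.val_zero] at this
    exact one_ne_zero this
  have hsub : ∀ x : ZMod p, ∃ v : ZMod p,
      AddMonoidHom.id (ZMod p) v - AddMonoidHom.id (ZMod p) (AffExt.act (mulEnd u) (1 : ZMod q) v) = x := by
    intro x
    have h1u : (1 - u) ≠ 0 := sub_ne_zero.2 (Ne.symm hu1)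
    refine ⟨x / (1 - u), ?_⟩
    rw [AddMonoidHom.id_apply, AddMonoidHom.id_apply, affExt_act_eq, act, ZMod.val_one, pow_one]
    field_simp
  have h := AffExt.not_boxUseful_of_oneRotation (mulEnd u) (AddMonoidHom.id (ZMod p)) (fun x => ⟨x, rfl⟩) hsub h1 hp9 hL
  unfold BoxUseful at h
  push Not at h
  obtain ⟨Y, W, hY, hW, I, hI, hind, hbig⟩ := h
  exact not_boxUseful_of_injective _ (ofAffExt_injective (q := q) u) hY hW hI hind hbig

end MetaCyc

/-! ### The atom hypothesis for every pair of primes -/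

/-- The primes `p` admitting a prime `q ≥ 5` with `q ∣ p − 1` satisfy `p ≥ 9` and `5⌈p/6⌉ ≤ p` (they are `≥ 11` and not `13, 19`).
[folklore] -/
theorem nine_le_of_dvd {p q : ℕ} (hp : p.Prime) (hq : q.Prime) (h5 : 5 ≤ q) (hdvd : q ∣ p - 1) :
    9 ≤ p ∧ 5 * ((p + 5) / 6) ≤ p := by
  have h2 := hp.two_le
  have hq_le : q ≤ p - 1 := Nat.le_of_dvd (by omega) hdvd
  by_cases h25 : 25 ≤ p
  · omega
  · have hp25 : p < 25 := not_le.1 h25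
    have hq25 : q < 25 := by omega
    interval_cases p <;> first
      | omega
      | (exfalso; revert hp; decide)
      | (exfalso; interval_cases q <;> first | omega | (revert hq; decide))

/-- **`q ∣ p − 1`, `q ≥ 5` ⇒ `AtomBad p q`.**  A non-trivial `q`-th root of unity exists mod `p` (Cauchy in `(ℤ/p)ˣ`), the
rank-one Frobenius bridge (`atomBad_of_frobenius_models`) reduces to the groups `ℤ/p ⋊_v ℤ/q`, and those are box-useless by
`MetaCyc.not_boxUseful_of_prime`. [folklore] -/
theorem atomBad_of_dvd {p q : ℕ} (hp : p.Prime) (hq : q.Prime) (hpq : p ≠ q) (h5 : 5 ≤ q) (hdvd : q ∣ p - 1) :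
    AtomBad.{u} p q := by
  haveI : Fact p.Prime := ⟨hp⟩
  haveI : Fact q.Prime := ⟨hq⟩
  obtain ⟨hp9, hL⟩ := nine_le_of_dvd hp hq h5 hdvd
  -- a `q`-th root of unity `u ≠ 1` mod `p`
  have hcard : q ∣ Fintype.card (ZMod p)ˣ := by rw [ZMod.card_units p]; exact hdvd
  obtain ⟨g, hg⟩ := exists_prime_orderOf_dvd_card q hcard
  have hu : ((g : ZMod p)) ^ q = 1 := by
    rw [← Units.val_pow_eq_pow_val, ← hg, pow_orderOf_eq_one, Units.val_one]
  have hu1 : (g : ZMod p) ≠ 1 := by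
    intro h1
    have hg1 : g = 1 := Units.val_eq_one.1 h1
    rw [hg1, orderOf_one] at hg
    omega
  refine atomBad_of_frobenius_models hpq (g : ZMod p) hu hu1 fun v _ hv1 => ?_
  haveI : NeZero q := ⟨hq.ne_zero⟩
  exact MetaCyc.not_boxUseful_of_prime hq.one_lt hp9 hL v hv1

/-- **THE ATOM HYPOTHESIS IS A THEOREM: `AtomBad p q` for all primes `p ≠ q` with `q ≥ 5`** (every finite group carrying an
`A(p,q)`-configuration — in particular every Schmidt atom `𝔽_{p^k} ⋊ C_q` and every Frobenius group `𝔽_p^m ⋊ C_q` — is not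
box-useful). [folklore] -/
theorem atomBad_of_five_le {p q : ℕ} (hp : p.Prime) (hq : q.Prime) (hpq : p ≠ q) (h5 : 5 ≤ q) : AtomBad.{u} p q := by
  haveI : Fact p.Prime := ⟨hp⟩
  by_cases hdvd : q ∣ p - 1
  · exact atomBad_of_dvd hp hq hpq h5 hdvd
  · exact atomBad_of_not_dvd hq hpq hdvd

/-! ### C9 (b) for every finite solvable group -/

/-- **C9 (b) HOLDS FOR EVERY FINITE SOLVABLE GROUP (unconditional).**  If a finite solvable group `H` is box-useful
(`α(H; |H|, 3, 3) < (9/5)|H|`), then `[H : Z(H)] ∈ {1, 4, 6}` or `H` carries the `𝒞₂` coordinate package `DihC3Sq.Coord2`.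
Assembly: `boxRatioSectionLaw_of_isSolvable_of_atomBad_five` (kernel-l4 gens 16–17: centre lifting, centreless endgame,
reduction to Schmidt atoms) with the atom hypothesis `atomBad_of_five_le`. [folklore] -/
theorem boxRatioSectionLaw_of_isSolvable_all (H : Type u) [Group H] [Fintype H] [DecidableEq H] [IsSolvable H]
    (hH : BoxUseful H) :
    (Subgroup.center H).index = 1 ∨ (Subgroup.center H).index = 4 ∨ (Subgroup.center H).index = 6 ∨
      ∃ (c₁ c₂ : H) (κ₁ κ₂ ε : H → ZMod 3), DihC3Sq.Coord2 c₁ c₂ κ₁ κ₂ ε :=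
  boxRatioSectionLaw_of_isSolvable_of_atomBad_five (fun _ _ hp hq hpq h5 => atomBad_of_five_le hp hq hpq h5) H hH

/-- **`BoxRatioSectionLaw` (C9 (b) for every finite group) follows from the single hypothesis (S): every finite non-abelian
simple group is not box-useful.** [folklore] -/
theorem boxRatioSectionLaw_of_simple
    (hS : ∀ (S : Type) [Group S] [Fintype S] [DecidableEq S], IsSimpleGroup S → (∃ a b : S, a * b ≠ b * a) →
      ¬ BoxUseful S) :
    BoxRatioSectionLaw :=
  boxRatioSectionLaw_of_atomBad_five_of_simple (fun _ _ hp hq hpq h5 => atomBad_of_five_le hp hq hpq h5) hS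

end Summit.MatrixMultiplication.OmegaCensus
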